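import Literature.AnabelianGeometry.AbsoluteAnabelian.AbsTopITemperedCusps
import Literature.AnabelianGeometry.SemiGraphs.TemperedMaximalCompactFiniteAt
import Literature.AnabelianGeometry.SemiGraphs.Prop36HypothesesWitnessAffChart
import HarnessLib

/-!
# [AbsTopI] Prop 4.10 (iv) (`VerticialEdgeLikeCharacterized`, FACT-LIST F-0255) AT THE GENUINE CARRIER:
# the tempered fundamental group of a FINITE semi-graph of anabelioids ([SemiAnbd] Thm 3.7 (iv))

S. Mochizuki, *Topics in Absolute Anabelian Geometry I: Generalities*, J. Math. Sci. Univ. Tokyo **19** (2012)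
[AbsTopI], Prop. 4.10 (iv), manuscript p. 60 [cite: MochizukiAbsTopI2012, Prop 4.10 (iv) p.60]: "The verticial
(respectively, edge-like) subgroups of `H[l]` may be characterized ["group-theoretically"] as the maximal compact
subgroups (respectively, nontrivial intersections of two distinct maximal compact subgroups) of `H[l]`" — where
`H[l]` is the tempered fundamental group of a FINITE semi-graph of (pro-`l`) anabelioids (the co-free completion of
`H` along the dual semi-graph `Γ_H`), and the cited input is S. Mochizuki, *Semi-graphs of anabelioids*, Publ. RIMS
**42** (2006) [SemiAnbd], Thm. 3.7 (iv) p. 41 [cite: MochizukiSemiAnbd2006, Thm 3.7(iv) p.41].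

PROOF-ONLY companion (cell abc-iut, D-0079 L-F sub-cell [AbsTop*], `plan/L4/LF-ABSTOP.tsv` row F-0255, abc-iut-L4-lead
m35 (d); seat abc-iut-w5-d042).  abc-iut-L4-t4's typed row `VerticialEdgeLikeCharacterized verticial edgeLike`
(`AbsTopITemperedCusps.lean`, never edited) is a PREDICATE on abstract data `(H[l], verticial, edge-like)`; abc-iut
seat f-092 recorded its kernel status AS TYPED (`AbsTopITemperedCuspsFactRows.lean`: it holds at the canonical pair
«maximal compact / nontrivial pairwise intersections» for every topological group, is rigid, and its universal
closure fails at `H[l] = 1, verticial = ∅`).  HERE the predicate is PROVED AT A GENUINE CARRIER, i.e. with the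
verticial / edge-like families being THE verticial / (closed-)edge-like subgroups of [SemiAnbd] Thm. 3.7 (i)/(iii):
for every FINITE semi-graph of anabelioids `𝒢` satisfying the hypotheses of [SemiAnbd] Thm. 3.7 (abc-iut-L3's
`ProfiniteSemiGraph.Thm37Hypotheses`) and every chart `c` of its tempered fundamental group `π₁^temp(𝒢)`
(`TemperedPiChart`), from abc-iut-L3's landed Thm. 3.7 (iv) at finite `𝔾` — BOTH sentences —
(`isMaximalCompactSubgroup_iff_mem_verticialSubgroups_of_finiteGraph`,
`exists_maximalCompact_pair_iff_edgeLike_of_finiteGraph`, file `TemperedMaximalCompactFiniteAt.lean`), BY NAME.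

Reading of "edge-like" in (iv): the edge-like subgroups of CLOSED edges (an open edge abuts a single vertex, so its
group is never a nontrivial intersection of two DISTINCT maximal compact subgroups; print treats the cusps = open
edges separately in (vi)).  HONEST SCOPE: this is the instance at abc-iut-L3's carrier (finite semi-graph of
anabelioids), not the statement about THE `H[l]` of a hyperbolic orbicurve over an MLF, which the tree does not
construct.  [AbsTopI]/[SemiAnbd] are refereed prerequisite papers; nothing here bears on [IUTchIII] Cor. 3.12;
no side is taken; typed ≠ proved for anything not displayed.
-/

noncomputable section

namespace Literature.AnabelianGeometry.AbsoluteAnabelian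

open Literature.AnabelianGeometry.SemiGraphs Literature.AnabelianGeometry.SemiGraphs.ProfiniteSemiGraph

universe u

variable {𝒢 : ProfiniteSemiGraph.{u}} [Finite 𝒢.graph.Vertex] [Finite 𝒢.graph.Edge]

/-- abc-iut-L3's «maximal compact subgroup» ([SemiAnbd] Thm 3.7 (iv): `IsCompact K ∧ ∀ K', IsCompact K' → K ≤ K' →
K' = K`) is abc-iut-L4-t4's clause of `VerticialEdgeLikeCharacterized` (`… → V = W`), up to `eq_comm`.
[cite: MochizukiAbsTopI2012, Prop 4.10 (iv) p.60] -/
theorem isMaximalCompactSubgroup_iff_clause {G : Type u} [Group G] [TopologicalSpace G] (K : Subgroup G) :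
    SemiGraphs.IsMaximalCompactSubgroup K ↔
      (IsCompact (K : Set G) ∧ ∀ W : Subgroup G, IsCompact (W : Set G) → K ≤ W → K = W) :=
  ⟨fun h => ⟨h.1, fun W hW hle => (h.2 W hW hle).symm⟩, fun h => ⟨h.1, fun W hW hle => (h.2 W hW hle).symm⟩⟩

/-- **[AbsTopI] Prop. 4.10 (iv) AT THE GENUINE CARRIER (F-0255 instance form PROVED).**  For a FINITE semi-graph
of anabelioids `𝒢` satisfying the hypotheses of [SemiAnbd] Thm. 3.7 and any chart `c` of `π₁^temp(𝒢)`: THE verticial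
subgroups (`verticialSubgroups c v`, all vertices `v`) are exactly the maximal compact subgroups of `π₁^temp(𝒢)`, and
THE nontrivial edge-like subgroups of closed edges (`edgeLikeSubgroups c e`, `e` closed) are exactly the nontrivial
intersections of two distinct maximal compact subgroups — i.e. abc-iut-L4-t4's predicate
`VerticialEdgeLikeCharacterized` holds at these families.  Inputs BY NAME: abc-iut-L3's [SemiAnbd] Thm. 3.7 (iv)
at finite `𝔾`, both sentences. [cite: MochizukiAbsTopI2012, Prop 4.10 (iv) p.60]
[cite: MochizukiSemiAnbd2006, Thm 3.7(iv) p.41] -/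
theorem verticialEdgeLikeCharacterized_temperedPiChart_of_finiteGraph (h𝒢 : 𝒢.Thm37Hypotheses)
    (c : TemperedPiChart 𝒢) :
    VerticialEdgeLikeCharacterized (Hl := c.G)
      {K | ∃ v : 𝒢.graph.Vertex, K ∈ verticialSubgroups c v}
      {L | L ≠ ⊥ ∧ ∃ e : 𝒢.graph.Edge, 𝒢.graph.IsClosedEdge e ∧ L ∈ edgeLikeSubgroups c e} := by
  -- first sentence of Thm 3.7 (iv): verticial = maximal compact
  have hV : {K : Subgroup c.G | ∃ v : 𝒢.graph.Vertex, K ∈ verticialSubgroups c v} =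
      {V : Subgroup c.G | IsCompact (V : Set c.G) ∧
        ∀ W : Subgroup c.G, IsCompact (W : Set c.G) → V ≤ W → V = W} := by
    ext K
    simp only [Set.mem_setOf_eq]
    rw [← isMaximalCompactSubgroup_iff_clause,
      isMaximalCompactSubgroup_iff_mem_verticialSubgroups_of_finiteGraph h𝒢 c K]
  refine ⟨hV, ?_⟩
  -- second sentence of Thm 3.7 (iv): nontrivial closed-edge edge-like = nontrivial intersections of two distinct
  -- maximal compact subgroups (= of two distinct verticial subgroups, by the first sentence)
  ext L
  simp only [Set.mem_setOf_eq]
  constructor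
  · rintro ⟨hL, e, he, hLe⟩
    obtain ⟨K₁, K₂, hK₁, hK₂, hne, hLeq⟩ :=
      (exists_maximalCompact_pair_iff_edgeLike_of_finiteGraph h𝒢 c hL).2 ⟨e, he, hLe⟩
    exact ⟨hL, K₁, (isMaximalCompactSubgroup_iff_mem_verticialSubgroups_of_finiteGraph h𝒢 c K₁).1 hK₁, K₂,
      (isMaximalCompactSubgroup_iff_mem_verticialSubgroups_of_finiteGraph h𝒢 c K₂).1 hK₂, hne, hLeq⟩
  · rintro ⟨hL, K₁, hK₁, K₂, hK₂, hne, hLeq⟩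
    obtain ⟨e, he, hLe⟩ := (exists_maximalCompact_pair_iff_edgeLike_of_finiteGraph h𝒢 c hL).1
      ⟨K₁, K₂, (isMaximalCompactSubgroup_iff_mem_verticialSubgroups_of_finiteGraph h𝒢 c K₁).2 hK₁,
        (isMaximalCompactSubgroup_iff_mem_verticialSubgroups_of_finiteGraph h𝒢 c K₂).2 hK₂, hne, hLeq⟩
    exact ⟨hL, e, he, hLe⟩

/-- The same, packaged with f-092's rigidity: at the genuine carrier the pair (THE verticial subgroups, THE nontrivial
closed-edge edge-like subgroups) is THE UNIQUE pair satisfying abc-iut-L4-t4's predicate — "may be characterized".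
[cite: MochizukiAbsTopI2012, Prop 4.10 (iv) p.60] -/
theorem verticialEdgeLikeCharacterized_iff_eq_genuine_of_finiteGraph (h𝒢 : 𝒢.Thm37Hypotheses)
    (c : TemperedPiChart 𝒢) (verticial edgeLike : Set (Subgroup c.G)) :
    VerticialEdgeLikeCharacterized verticial edgeLike ↔
      verticial = {K | ∃ v : 𝒢.graph.Vertex, K ∈ verticialSubgroups c v} ∧
        edgeLike = {L | L ≠ ⊥ ∧ ∃ e : 𝒢.graph.Edge, 𝒢.graph.IsClosedEdge e ∧ L ∈ edgeLikeSubgroups c e} := by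
  have hg := verticialEdgeLikeCharacterized_temperedPiChart_of_finiteGraph h𝒢 c
  constructor
  · intro h
    obtain ⟨hv, he⟩ := h
    obtain ⟨hv', he'⟩ := hg
    exact ⟨hv.trans hv'.symm, by rw [he, he', hv.trans hv'.symm]⟩
  · rintro ⟨rfl, rfl⟩
    exact hg


/-! ### Non-vacuity: the characterisation at an INHABITED genuine carrier -/

/-- **Non-vacuity of the genuine instance**: abc-iut-L3's one-vertex witness `affWitness p` (vertex group
`Aff(ℤ_p)`, no edges; `affWitness_thm37Hypotheses`) with its explicit chart `affChart p` satisfies the hypotheses,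
so abc-iut-L4-t4's predicate holds there for THE verticial / closed-edge-like families (the latter empty: no edges).
[cite: MochizukiAbsTopI2012, Prop 4.10 (iv) p.60] -/
theorem verticialEdgeLikeCharacterized_affChart (p : ℕ) [Fact p.Prime] :
    VerticialEdgeLikeCharacterized (Hl := (affChart p).G)
      {K | ∃ v : (affWitness p).graph.Vertex, K ∈ verticialSubgroups (affChart p) v}
      {L | L ≠ ⊥ ∧ ∃ e : (affWitness p).graph.Edge,
        (affWitness p).graph.IsClosedEdge e ∧ L ∈ edgeLikeSubgroups (affChart p) e} := by
  haveI : Finite (affWitness p).graph.Vertex := inferInstanceAs (Finite PUnit)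
  haveI : Finite (affWitness p).graph.Edge := inferInstanceAs (Finite PEmpty)
  exact verticialEdgeLikeCharacterized_temperedPiChart_of_finiteGraph affWitness_thm37Hypotheses (affChart p)

end Literature.AnabelianGeometry.AbsoluteAnabelian

end
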